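import Summits.RiemannHypothesis.RiemannHypothesis.Theorems.TiltedLandingLaw421R3FarStep

/-! # TiltedLandingLaw421R3FarStep2 — W-08 RATE^B support: the FAR STEP in POSITION FORM (C3 g38 RESULT-1 (T3), c₀ = 4/5)
PART 2 of the far-step kit, against the TREE module `…R3FarStep` (#1045, = C4 g28 part 1 §F.1–§F.5 landed by betaR g3): §F.6 only —
`normSq_pairQ`, `far_core_ineq` (the polynomial certificate), ★★ `far_step_position` (H-SIGN `‖w − a‖ ≤ b` + H-FAR `‖q(w)‖ ≤ 2b‖w − a‖` + H-M
`2‖w − a‖ ≤ M‖q(w)‖` ⇒ `(4/5)/M² ≤ b² − Im w²`), `position_of_field` (bridge from `‖K‖ ≤ M`, `1 ≤ b‖K‖` via `q(w)·K = −2(w − a)`),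
★★★ `far_step_energy_of_field`, `far_step_energy_eta` (`(4/5)·s² ≤ η²·(b² − Im w²)`). C3 g38: exact infimum of the constant is `2√2 − 2` under
sign + far alone; `c → 1` needs a tilt bound (cf. `drop_formula` of part 1). SUPPORT for crux `TiltedLandingLaw421` (stmt-RiemannHypothesis-24774),
`--supports … --as helper` only; sorry-free. Nothing here bears on the truth of RH; RH is NOT proved; 24774 OPEN. -/

namespace RhW08.FarStep

open Complex Metric Set
open scoped ComplexConjugate
open RhW08.IsolatedTilt

/-! ## §F.6 PART 2 — C3 g38 RESULT-1 «THE FAR STEP» in POSITION FORM: H-SIGN + H-FAR + H-M ⟹ drop ≥ (4/5)/M² (exact infimum 2√2 − 2) -/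

/-- (K) §F.6 `|q(w)|² = (|w − a|² + b²)² − 4b²·Im w²`. -/
theorem normSq_pairQ (a b : ℝ) (w : ℂ) :
    Complex.normSq (pairQ a b w) = (Complex.normSq (w - a) + b ^ 2) ^ 2 - 4 * b ^ 2 * w.im ^ 2 := by
  rw [Complex.normSq_apply, Complex.normSq_apply, pairQ_re, pairQ_im, Complex.sub_re, Complex.sub_im, Complex.ofReal_re,
    Complex.ofReal_im, sub_zero]
  ring

/-- ★ (K) §F.6 **THE CORE INEQUALITY** (C3 (T3) with the rational constant `c₀ = 4/5 ≤ 2√2 − 2`): for `0 ≤ t ≤ s ≤ B`, `0 < B` and the far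
clause `(s + B)² − 4Bt ≤ 4Bs` one has `(s + B)² − 4Bt ≤ 5·s·(B − t)` (here `s = |w − a|²`, `t = Im w²`, `B = b²`, `(s+B)² − 4Bt = |q(w)|²`). -/
theorem far_core_ineq {s t B : ℝ} (hB : 0 < B) (ht0 : 0 ≤ t) (hts : t ≤ s) (hsB : s ≤ B)
    (hfar : (s + B) ^ 2 - 4 * B * t ≤ 4 * B * s) : (s + B) ^ 2 - 4 * B * t ≤ 5 * s * (B - t) := by
  have hlow : (B - s) ^ 2 ≤ 4 * B * t := by nlinarith [hfar]
  have hs6 : B ≤ 6 * s := by nlinarith [hlow, hts, sq_nonneg s]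
  have hs0 : 0 ≤ s := le_trans ht0 hts
  by_cases hc : 5 * s ≤ 4 * B
  · have h1 : 0 ≤ (4 * B * t - (B - s) ^ 2) * (4 * B - 5 * s) := mul_nonneg (by linarith) (by linarith)
    have h2 : (B - s) ^ 2 ≤ (5 * B / 6) ^ 2 := by
      have h3 : 0 ≤ B - s := by linarith
      have h4 : B - s ≤ 5 * B / 6 := by linarith
      nlinarith [h3, h4]
    have h5 : 0 ≤ 4 * B ^ 2 - 5 * (B - s) ^ 2 := by nlinarith [h2]
    have key : 4 * B * (5 * s * (B - t) - ((s + B) ^ 2 - 4 * B * t))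
        = (4 * B * t - (B - s) ^ 2) * (4 * B - 5 * s) + s * (4 * B ^ 2 - 5 * (B - s) ^ 2) := by ring
    have h6 : 0 ≤ 4 * B * (5 * s * (B - t) - ((s + B) ^ 2 - 4 * B * t)) := by
      rw [key]; exact add_nonneg h1 (mul_nonneg hs0 h5)
    nlinarith [h6, hB]
  · push Not at hc
    have h1 : 0 ≤ (s - t) * (5 * s - 4 * B) := mul_nonneg (by linarith) (by linarith)
    have h2 : 0 ≤ (6 * s - B) * (B - s) := mul_nonneg (by linarith) (by linarith)
    nlinarith [h1, h2]

/-- ★★ (K) §F.6 **THE FAR STEP, POSITION FORM** (C3 g38 RESULT-1 (T3), c₀ = 4/5): an upper point `w` that is NESTED (`|w − a| ≤ b`, = H-SIGN),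
FAR (`|q(w)| ≤ 2b·|w − a|`, = `b·|κ| ≥ 1`) and has BOUNDED position-field (`2|w − a| ≤ M·|q(w)|`, = `|κ| ≤ M`) satisfies `Im w² ≤ b² − (4/5)/M²`.
Pure position algebra — no critical-point equation, no cofactor. -/
theorem far_step_position {w : ℂ} {a b M : ℝ} (hb : 0 < b) (hw : 0 < w.im) (hM0 : 0 < M)
    (hsign : ‖w - a‖ ≤ b) (hfar : ‖pairQ a b w‖ ≤ 2 * b * ‖w - a‖) (hM : 2 * ‖w - a‖ ≤ M * ‖pairQ a b w‖) :
    4 / 5 / M ^ 2 ≤ b ^ 2 - w.im ^ 2 := by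
  set s : ℝ := ‖w - (a : ℂ)‖ ^ 2 with hs_def
  have hs_eq : s = (w.re - a) ^ 2 + w.im ^ 2 := by
    rw [hs_def, ← Complex.normSq_eq_norm_sq, Complex.normSq_apply, Complex.sub_re, Complex.sub_im, Complex.ofReal_re,
      Complex.ofReal_im, sub_zero]
    ring
  have hP : ‖pairQ a b w‖ ^ 2 = (s + b ^ 2) ^ 2 - 4 * b ^ 2 * w.im ^ 2 := by
    rw [← Complex.normSq_eq_norm_sq, normSq_pairQ, Complex.normSq_eq_norm_sq]
  have hts : w.im ^ 2 ≤ s := by rw [hs_eq]; nlinarith [sq_nonneg (w.re - a)]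
  have ht0 : 0 ≤ w.im ^ 2 := sq_nonneg _
  have hsB : s ≤ b ^ 2 := by
    rw [hs_def]
    have := mul_self_le_mul_self (norm_nonneg _) hsign
    nlinarith [this]
  have hspos : 0 < s := by rw [hs_eq]; nlinarith [sq_nonneg (w.re - a), mul_pos hw hw]
  have hfar2 : (s + b ^ 2) ^ 2 - 4 * b ^ 2 * w.im ^ 2 ≤ 4 * b ^ 2 * s := by
    rw [← hP, hs_def]
    have h0 : 0 ≤ 2 * b * ‖w - (a : ℂ)‖ := by positivity
    have := mul_self_le_mul_self (norm_nonneg _) hfar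
    nlinarith [this]
  have hM2 : 4 * s ≤ M ^ 2 * ((s + b ^ 2) ^ 2 - 4 * b ^ 2 * w.im ^ 2) := by
    rw [← hP, hs_def]
    have h0 : 0 ≤ 2 * ‖w - (a : ℂ)‖ := by positivity
    have := mul_self_le_mul_self h0 hM
    nlinarith [this]
  have hcore := far_core_ineq (pow_pos hb 2) ht0 hts hsB hfar2
  have h1 : 4 * s ≤ M ^ 2 * (5 * s * (b ^ 2 - w.im ^ 2)) :=
    le_trans hM2 (mul_le_mul_of_nonneg_left hcore (sq_nonneg M))
  have h2 : 4 ≤ 5 * M ^ 2 * (b ^ 2 - w.im ^ 2) := by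
    by_contra h3
    push Not at h3
    nlinarith [h1, hspos, h3]
  have hM2pos : 0 < M ^ 2 := pow_pos hM0 2
  rw [div_div, div_le_iff₀ (by positivity)]
  linarith

/-- (K) §F.6 BRIDGE from the FIELD to the position clauses via §F.1's identity `q(w)·K = −2(w − a)`:
`|K| ≤ M` gives H-M and `1 ≤ b·|K|` gives H-FAR. -/
theorem position_of_field {w K : ℂ} {a b M : ℝ} (h : pairQ a b w * K = -(2 * (w - a))) (hb : 0 ≤ b)
    (hKM : ‖K‖ ≤ M) (hK1 : 1 ≤ b * ‖K‖) :
    2 * ‖w - a‖ ≤ M * ‖pairQ a b w‖ ∧ ‖pairQ a b w‖ ≤ 2 * b * ‖w - a‖ := by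
  have hn : ‖pairQ a b w‖ * ‖K‖ = 2 * ‖w - a‖ := by
    rw [← norm_mul, h, norm_neg, norm_mul, Complex.norm_ofNat]
  refine ⟨?_, ?_⟩
  · rw [← hn, mul_comm]
    exact mul_le_mul_of_nonneg_right hKM (norm_nonneg _)
  · have : ‖pairQ a b w‖ * 1 ≤ ‖pairQ a b w‖ * (b * ‖K‖) := mul_le_mul_of_nonneg_left hK1 (norm_nonneg _)
    nlinarith [this, hn, norm_nonneg (pairQ a b w), norm_nonneg K]

/-- ★★★ (K) §F.6 **THE FAR STEP FOR betaR** (field form, frame-free): `G = q·h` on `ball a ρ`, an UPPER critical point `w` of `G` in the ball with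
`h w ≠ 0`, NESTED `|w − a| ≤ b`, field value `K := h′(w)/h(w)` with `1 ≤ b·|K|` (far: no landing) and `|K| ≤ M`
⇒ `(4/5)/M² ≤ b² − Im w²`. With `M = η/s`: `(4/5)·s² ≤ η²·(b² − Im w²)` — the `FarEnergyLawQ` summand up to the constant `4/5`
(C3: exact infimum `2√2 − 2 ≈ 0.828` under sign + far alone; `c → 1` only with a tilt bound, cf. `drop_formula`). -/
theorem far_step_energy_of_field {G h : ℂ → ℂ} {a b ρ M : ℝ} (hh : DifferentiableOn ℂ h (ball (a : ℂ) ρ))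
    (hG : ∀ z ∈ ball (a : ℂ) ρ, G z = pairQ a b z * h z) {w : ℂ} (hw : w ∈ ball (a : ℂ) ρ) (hhw : h w ≠ 0)
    (hcrit : deriv G w = 0) (hb : 0 < b) (hwim : 0 < w.im) (hM0 : 0 < M) (hsign : ‖w - a‖ ≤ b)
    (hK1 : 1 ≤ b * ‖deriv h w / h w‖) (hKM : ‖deriv h w / h w‖ ≤ M) :
    4 / 5 / M ^ 2 ≤ b ^ 2 - w.im ^ 2 := by
  have hid := crit_field_identity hh hG hw hhw hcrit
  obtain ⟨hM, hfar⟩ := position_of_field hid hb.le hKM hK1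
  exact far_step_position hb hwim hM0 hsign hfar hM

/-- (K) §F.6 … in the far-law currency `M = η/s`: `(4/5)·s² ≤ η²·(b² − Im w²)`. -/
theorem far_step_energy_eta {G h : ℂ → ℂ} {a b ρ η s : ℝ} (hh : DifferentiableOn ℂ h (ball (a : ℂ) ρ))
    (hG : ∀ z ∈ ball (a : ℂ) ρ, G z = pairQ a b z * h z) {w : ℂ} (hw : w ∈ ball (a : ℂ) ρ) (hhw : h w ≠ 0)
    (hcrit : deriv G w = 0) (hb : 0 < b) (hwim : 0 < w.im) (hη : 0 < η) (hs : 0 < s) (hsign : ‖w - a‖ ≤ b)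
    (hK1 : 1 ≤ b * ‖deriv h w / h w‖) (hKM : ‖deriv h w / h w‖ ≤ η / s) :
    4 / 5 * s ^ 2 ≤ η ^ 2 * (b ^ 2 - w.im ^ 2) := by
  have h1 := far_step_energy_of_field hh hG hw hhw hcrit hb hwim (div_pos hη hs) hsign hK1 hKM
  have hηs : 4 / 5 / (η / s) ^ 2 = 4 / 5 * s ^ 2 / η ^ 2 := by field_simp
  rw [hηs, div_le_iff₀ (by positivity)] at h1
  linarith

end RhW08.FarStep
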